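import Summits.CriticalPhenomena.Ising3DConformalLimit.Theorems.EnergyNotSigmaSquaredMoebiusLimitExistsDefs
import Summits.CriticalPhenomena.Ising3DConformalLimit.Theorems.PrecisionLaplacianMoebiusLimitOfTwoPointLawInversionBegetsRotations
import HarnessLib

/-!
# Stub `stub_subsequentialInversionTransfer` (K3) of crux `ReflectionTwin.ExistsContinuousLimit`
# (stmt-CriticalPhenomena-4582), line `Sketch`

Support file for the crux `ReflectionTwin.ExistsContinuousLimit` (item stmt-CriticalPhenomena-4582, shared
verbatim with `LogPolarProxy.ExistsContinuousLimit`), sub-problem `Ising3DConformalLimit`, line `Sketch`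
(`Cruxes/ExistsContinuousLimit/Lines/Sketch.lean`): it proves the registered stub
`stub_subsequentialInversionTransfer` (K3, "subsequential inversion transfer"), one of the four hypotheses of
the sorry-free composition `ExistsContinuousLimit_of`.

**The stub is free of Ising input: it is limit bookkeeping.** Lattice correlation families `P k` are
EXACTLY invariant under the unit inversion `ι v = v/‖v‖²` off the origin; after local renormalisation by the
pinned `ρ_pin(u_k‖pᵢ‖)` they converge to `S` locally uniformly on the non-coincident configurations off the
origin along meshes `u_k → 0⁺`; and the pinned weight ratios `ρ_pin(u_k‖p‖)/ρ_pin(u_k/‖p‖)` converge to a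
continuous positive `w` off the origin. Then `S (ι ∘ x) = (∏ᵢ w'(xᵢ)) S x` off the origin with the
continuous positive weight `w' = w⁻¹`.

Proof (`apply_eq_prod_mul_apply_inversion`). Fix `n` and `x` with all `xᵢ ≠ 0`. If `x` is not injective,
neither is `ι ∘ x`, and both sides vanish by the normalisation of `S`. Otherwise `ι ∘ x` is injective and off
the origin with `‖ι xᵢ‖ = ‖xᵢ‖⁻¹`, so pointwise (`TendstoLocallyUniformlyOn.tendsto_at`)
`A_k := (∏ᵢ ρ_pin(u_k‖xᵢ‖)) P_k x → S x` and, by the exact symmetry `P_k (ι ∘ x) = P_k x`,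
`B_k := (∏ᵢ ρ_pin(u_k/‖xᵢ‖)) P_k x → S (ι ∘ x)`; the ratios give `R_k := ∏ᵢ ρ_pin(u_k‖xᵢ‖)/ρ_pin(u_k/‖xᵢ‖) →
∏ᵢ w(xᵢ)`. Eventually `0 < u_k ≤ minᵢ ‖xᵢ‖`, so `ρ_pin(u_k/‖xᵢ‖) > 0` (`rhoPin_pos`) and `A_k = R_k B_k`
exactly; uniqueness of limits gives `S x = (∏ᵢ w(xᵢ)) S (ι ∘ x)`, and dividing by `∏ᵢ w(xᵢ) > 0` the claim.
Nothing here is specific to the Ising model. [folklore]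
-/

noncomputable section

namespace Summit.CriticalPhenomena.Ising3DConformalLimit.ReflectionTwinExistsContinuousLimit

open Filter Topology Set Function
open Literature.Probability.LatticeModels EuclideanGeometry
open Summit.CriticalPhenomena.Ising3DConformalLimit.MoebiusLimitExistsOnlyInteraction (rhoPin rhoPin_pos)
open Summit.CriticalPhenomena.Ising3DConformalLimit.PrecisionLaplacianMoebiusLimitOfTwoPointLaw
  (norm_inversion_zero_one)

/-- **The transfer at one configuration off the origin.** Under the hypotheses of
`stub_subsequentialInversionTransfer` (exact unit-inversion symmetry of the `P k`, meshes `u_k → 0⁺`,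
normalisation of `S`, locally uniform convergence of the renormalised `P k` to `S` off the diagonals and the
origin, convergence of the pinned weight ratios to `w` off the origin), for every configuration `x` off the
origin `S n x = (∏ i, w (x i)) * S n (ι ∘ x)`. No positivity or continuity of `w` is needed here. [folklore] -/
theorem apply_eq_prod_mul_apply_inversion
    {P : ℕ → CorrFamily 3} {u : ℕ → ℝ} {S : CorrFamily 3} {w : EuclideanSpace ℝ (Fin 3) → ℝ}
    (hP : ∀ (k n : ℕ) (p : Fin n → EuclideanSpace ℝ (Fin 3)), (∀ i, p i ≠ 0) →
      P k n (fun i => inversion (0 : EuclideanSpace ℝ (Fin 3)) 1 (p i)) = P k n p)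
    (hu : Tendsto u atTop (𝓝[>] (0 : ℝ)))
    (hN : ∀ n z, z ∉ NonCoincident 3 n → S n z = 0)
    (hconv : ∀ n, TendstoLocallyUniformlyOn
      (fun (k : ℕ) (p : Fin n → EuclideanSpace ℝ (Fin 3)) => (∏ i, rhoPin (u k * ‖p i‖)) * P k n p)
      (S n) atTop (NonCoincident 3 n ∩ {p | ∀ i, p i ≠ 0}))
    (hratio : TendstoLocallyUniformlyOn
      (fun (k : ℕ) (p : EuclideanSpace ℝ (Fin 3)) => rhoPin (u k * ‖p‖) / rhoPin (u k / ‖p‖))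
      w atTop {0}ᶜ)
    {n : ℕ} {x : Fin n → EuclideanSpace ℝ (Fin 3)} (hx : ∀ i, x i ≠ 0) :
    S n x = (∏ i, w (x i)) * S n (fun i => inversion (0 : EuclideanSpace ℝ (Fin 3)) 1 (x i)) := by
  by_cases hinj : x ∈ NonCoincident 3 n
  · -- the inverted configuration is non-coincident and off the origin
    have hιx0 : ∀ i, inversion (0 : EuclideanSpace ℝ (Fin 3)) 1 (x i) ≠ 0 := fun i h =>
      hx i ((inversion_eq_center one_ne_zero).1 h)
    have hιinj : (fun i => inversion (0 : EuclideanSpace ℝ (Fin 3)) 1 (x i)) ∈ NonCoincident 3 n := by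
      rw [mem_nonCoincident] at hinj ⊢
      exact (inversion_injective (0 : EuclideanSpace ℝ (Fin 3)) one_ne_zero).comp hinj
    -- the three pointwise limits
    have hA : Tendsto (fun k => (∏ i, rhoPin (u k * ‖x i‖)) * P k n x) atTop (𝓝 (S n x)) :=
      (hconv n).tendsto_at ⟨hinj, hx⟩
    have hB : Tendsto (fun k => (∏ i, rhoPin (u k / ‖x i‖)) * P k n x) atTop
        (𝓝 (S n (fun i => inversion (0 : EuclideanSpace ℝ (Fin 3)) 1 (x i)))) := by
      refine ((hconv n).tendsto_at ⟨hιinj, hιx0⟩).congr fun k => ?_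
      simp only [norm_inversion_zero_one, hP k n x hx, div_eq_mul_inv]
    have hR : Tendsto (fun k => ∏ i, rhoPin (u k * ‖x i‖) / rhoPin (u k / ‖x i‖)) atTop
        (𝓝 (∏ i, w (x i))) :=
      tendsto_finsetProd _ fun i _ => hratio.tendsto_at (mem_compl_singleton_iff.2 (hx i))
    -- eventually the pinned factors at the inverted scales are positive, so `A_k = R_k * B_k`
    have hpos : ∀ᶠ k in atTop, ∀ i, 0 < rhoPin (u k / ‖x i‖) := by
      rw [eventually_all]
      intro i
      have hxi : 0 < ‖x i‖ := norm_pos_iff.2 (hx i)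
      filter_upwards [hu.eventually_mem (Ioc_mem_nhdsGT hxi)] with k hk
      exact rhoPin_pos _ ⟨div_pos hk.1 hxi, div_le_one_of_le₀ hk.2 hxi.le⟩
    have hev : ∀ᶠ k in atTop, (∏ i, rhoPin (u k * ‖x i‖) / rhoPin (u k / ‖x i‖)) *
        ((∏ i, rhoPin (u k / ‖x i‖)) * P k n x) = (∏ i, rhoPin (u k * ‖x i‖)) * P k n x := by
      filter_upwards [hpos] with k hk
      rw [← mul_assoc, ← Finset.prod_mul_distrib]
      congr 1
      exact Finset.prod_congr rfl fun i _ => div_mul_cancel₀ _ (hk i).ne'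
    exact tendsto_nhds_unique hA ((hR.mul hB).congr' hev)
  · -- off `NonCoincident` both sides vanish
    have hιinj : (fun i => inversion (0 : EuclideanSpace ℝ (Fin 3)) 1 (x i)) ∉ NonCoincident 3 n := by
      intro h
      apply hinj
      rw [mem_nonCoincident] at h ⊢
      intro i j hij
      exact h (show inversion (0 : EuclideanSpace ℝ (Fin 3)) 1 (x i) = inversion 0 1 (x j) by rw [hij])
    rw [hN n x hinj, hN n _ hιinj, mul_zero]

/-- **Stub `stub_subsequentialInversionTransfer` (K3) of line `Sketch`, crux `ReflectionTwin.ExistsContinuousLimit`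
(stmt-CriticalPhenomena-4582), registered signature verbatim: subsequential inversion transfer.** If lattice
correlation families `P k`, EXACTLY invariant under the unit inversion off the origin, converge after local
renormalisation by the pinned `ρ_pin(u_k ‖pᵢ‖)` to a normalised family `S`, locally uniformly on the
non-coincident configurations off the origin, along meshes `u_k → 0⁺`, and the pinned weight ratios
`ρ_pin(u_k‖p‖)/ρ_pin(u_k/‖p‖)` converge locally uniformly off the origin to a continuous positive `w`, then
`S` is covariant under the unit inversion with the continuous positive weight `w' = w⁻¹`:
`S n (ι ∘ x) = (∏ i, (w (x i))⁻¹) * S n x` off the origin (`apply_eq_prod_mul_apply_inversion` divided by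
`∏ i, w (x i) > 0`). [folklore] -/
theorem stub_subsequentialInversionTransfer : ∀ (P : ℕ → Literature.Probability.LatticeModels.CorrFamily 3) (u : ℕ → ℝ) (S : Literature.Probability.LatticeModels.CorrFamily 3) (w : EuclideanSpace ℝ (Fin 3) → ℝ), (∀ (k n : ℕ) (p : Fin n → EuclideanSpace ℝ (Fin 3)), (∀ i, p i ≠ 0) → P k n (fun i => EuclideanGeometry.inversion (0 : EuclideanSpace ℝ (Fin 3)) 1 (p i)) = P k n p) → Filter.Tendsto u Filter.atTop (nhdsWithin 0 (Set.Ioi 0)) → (∀ n z, z ∉ Literature.Probability.LatticeModels.NonCoincident 3 n → S n z = 0) → (∀ n, TendstoLocallyUniformlyOn (fun (k : ℕ) (p : Fin n → EuclideanSpace ℝ (Fin 3)) => (∏ i, Summit.CriticalPhenomena.Ising3DConformalLimit.MoebiusLimitExistsOnlyInteraction.rhoPin (u k * ‖p i‖)) * P k n p) (S n) Filter.atTop (Literature.Probability.LatticeModels.NonCoincident 3 n ∩ {p | ∀ i, p i ≠ 0})) → (∀ v, v ≠ 0 → 0 < w v) → ContinuousOn w {0}ᶜ → TendstoLocallyUniformlyOn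 (fun (k : ℕ) (p : EuclideanSpace ℝ (Fin 3)) => Summit.CriticalPhenomena.Ising3DConformalLimit.MoebiusLimitExistsOnlyInteraction.rhoPin (u k * ‖p‖) / Summit.CriticalPhenomena.Ising3DConformalLimit.MoebiusLimitExistsOnlyInteraction.rhoPin (u k / ‖p‖)) w Filter.atTop {0}ᶜ → ∃ w' : EuclideanSpace ℝ (Fin 3) → ℝ, (∀ v, v ≠ 0 → 0 < w' v) ∧ ContinuousOn w' {0}ᶜ ∧ ∀ (n : ℕ) (x : Fin n → EuclideanSpace ℝ (Fin 3)), (∀ i, x i ≠ 0) → S n (fun i => EuclideanGeometry.inversion (0 : EuclideanSpace ℝ (Fin 3)) 1 (x i)) = (∏ i, w' (x i)) * S n x := by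
  intro P u S w hP hu hN hconv hwpos hwcont hratio
  refine ⟨fun v => (w v)⁻¹, fun v hv => inv_pos.2 (hwpos v hv),
    hwcont.inv₀ fun v hv => (hwpos v (Set.mem_compl_singleton_iff.1 hv)).ne', fun n x hx => ?_⟩
  have hprod : 0 < ∏ i, w (x i) := Finset.prod_pos fun i _ => hwpos _ (hx i)
  rw [apply_eq_prod_mul_apply_inversion hP hu hN hconv hratio hx, Finset.prod_inv_distrib, ← mul_assoc,
    inv_mul_cancel₀ hprod.ne', one_mul]

end Summit.CriticalPhenomena.Ising3DConformalLimit.ReflectionTwinExistsContinuousLimit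

end
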